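import Summits.BirchSwinnertonDyer.Rank1Residual.X1.RankOneRegulatorSqueeze
import Literature.NumberTheory.EllipticCurves.Rank1Residual.Typed.CasselsLowerBound
import HarnessLib

/-!
# Route R on X1 ∩ {r = 1} with a `Ш`-DEFECT: `ord_p [T¹](ϖ·L_p) + 1 + 2·ord_p #E(ℚ)_tors ≤ v +
# ord_p ∏c_ℓ + 2·ord_p #Ẽ(𝔽_p) + k` together with a descent certificate `p^k ∣ #Ш(E/ℚ)[p^∞]`
# ⇒ Mazur's main conjecture ∧ `#Ш(E/ℚ)[p^∞] = p^k` ∧ `BSD(E,p)` — route R no longer needs `Ш[p^∞] = 0`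

HONEST FRAMING (cell `b2b-bsdres`, run/shared/lean/b2b/bsd-rank1-residual/, verbatim in every
file): the goal of the cell is to DELETE the COMBINATION-SHAPED residual classes of the
Birch–Swinnerton-Dyer formula for ALL analytic-rank `≤ 1` elliptic curves over `ℚ` — "full BSD
formula for every rank `≤ 1` curve in class `C`" assembled STRICTLY from published theorems — so
that the rank-`≤ 1` remainder becomes exactly the CONSTRUCTION-SHAPED classes, which are TYPED
(missing-input `Prop`s), NOT attempted. This is not "finishing BSD". CLASS-OWNERS.md: row
"X1 (r = 1)" — research route; NO CLAIM BEYOND STATED CLASSES; no label change; PER-PAIR certificate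
shape, not a class theorem; nothing is booked by this file; no preprint enters; NO definition, NO
named fact.

Unit `b2b-bsdres-x1a` (X1 prover A, gen 17). Fifth sequel of `X1/RankOneRegulatorSqueeze.lean`
(p263077; repair-census item R-8 of HOME/b2b-bsdres-x1a/gen16/ROUTE-R-R1.md §6). WHAT. Route R
(`core`, `RankOne.Leaf.mazurMainConjecture_and_bsdp_of_coeffOneVal_of_regulatorGE`) fires only when
`s := vc + 1 + 2·ord_p #tors − 2·ord_p #Ẽ(𝔽_p) − ord_p ∏c_ℓ − v = 0`, i.e. (TIER) when
`Ш(E/ℚ)[p^∞] = 0`; the IDENTITY behind it (`identity`: `s = ord_p #Ш(E/ℚ)[p^∞] + ord_p h(0)`, two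
non-negative integers) plainly allows more: if a DESCENT certifies `p^k ∣ #Ш(E/ℚ)[p^∞]` and `s ≤ k`,
then `ord_p h(0) = 0`, so `h ∈ Λˣ` — MAZUR'S MAIN CONJECTURE —, `#Ш(E/ℚ)[p^∞] = p^k` exactly, and
`BSD(E,p)` (x1a's `RankOne.Leaf.bsdp_of_mazurMainConjecture_of_schneider`, the coefficient being the
Schneider certificate). The `Ш`-certificate shapes are the tree's (x11b/x1b's
`Typed/CasselsLowerBound`): `p^k ∣ #Ш[p^∞]` directly (§2), or — with the Cassels–Tate pairing
(bsd.S18, `exists_casselsTate_pairing`, PUBLISHED) making `#Ш` a square and GZK making `Ш` finite on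
the leaf — ONE non-zero element of `Ш(E/ℚ)[p]` for `k = 2` (§3; `p^{2k−1} ∣ #Ш` for `2k` in general).
So route R's reach at rank one becomes: Mazur's MC is certified at EVERY X1 rank-one pair where it
holds, given (i) `ord_p c₁`, (ii) `ord_p Reg_p`, (iii) a descent matching `s` — the pairs with
`p ∣ #Ш(E′)_an` at every isogenous `E′` (census: 371522j @3, the single type-B class with
`#Ш_an = 9` at both curves; 0 type-A classes, `N < 5·10⁵`) are no longer outside the route's
currency, only outside today's certificate tables.

References: [Wuthrich2014] Thm. 16; [BalakrishnanMullerStein2015] Thm. 1.7; [MazurSteinTate2006]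
Thm. 1.3; [PerrinRiou1987] §1.4 Cor. 1.8; [SilvermanAEC2009] Thm. X.4.14 (Cassels–Tate);
[MilneADT2006] Thm. I.7.3; HOME/b2b-bsdres-x1a/X1-CHAIN.md §25–§26.
-/

noncomputable section

open scoped Classical MatrixGroups ModularForm

open PowerSeries CongruenceSubgroup WeierstrassCurve Literature.NumberTheory.EllipticCurves
  Literature.NumberTheory.EllipticCurves.ModularForms
  Literature.NumberTheory.EllipticCurves.Wuthrich2014
  Literature.NumberTheory.EllipticCurves.Rank1Residual
  Summit.BirchSwinnertonDyer.BirchSwinnertonDyer.Theorems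
  Summit.BirchSwinnertonDyer.BirchSwinnertonDyer.Theorems.Rank1ResidualX1Defs
  Summit.BirchSwinnertonDyer.Rank1Residual.X1.MuLambda
  Summit.BirchSwinnertonDyer.Rank1Residual.X1.EisensteinSqueeze
  Summit.BirchSwinnertonDyer.Rank1Residual.X1.RankOneLeadingTermSqueeze

set_option autoImplicit false

namespace Summit.BirchSwinnertonDyer.Rank1Residual.X1.RankOneRegulatorSqueeze

/-! ## §1. Elementary: the order of a finite `p`-group divisible by `p^k` with valuation `≤ k` is `p^k` -/

/-- If `#A(p)` (a finite `p`-primary component, hence of `p`-power order) is divisible by `p^k` and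
`ord_p #A(p) ≤ k` then `#A(p) = p^k`. [folklore] -/
theorem card_addPrimaryComponent_eq_pow_of_dvd_of_le {A : Type*} [AddCommGroup A] {p : ℕ}
    [Fact p.Prime] [Finite (AddCommGroup.primaryComponent A p)] {k : ℕ}
    (hdvd : p ^ k ∣ Nat.card (AddCommGroup.primaryComponent A p))
    (hle : padicValNat p (Nat.card (AddCommGroup.primaryComponent A p)) ≤ k) :
    Nat.card (AddCommGroup.primaryComponent A p) = p ^ k := by
  have hpP : p.Prime := Fact.out
  obtain ⟨n, hn⟩ := exists_card_addPrimaryComponent_eq_pow (A := A) p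
  rw [hn, padicValNat.prime_pow] at hle
  rw [hn] at hdvd ⊢
  have hkn : k ≤ n := (Nat.pow_dvd_pow_iff_le_right hpP.one_lt).mp hdvd
  rw [le_antisymm hle hkn]

/-- `p^k ∣ #A(p)` for a finite `p`-primary component gives `k ≤ ord_p #A(p)`. [folklore] -/
theorem le_padicValNat_card_of_pow_dvd {A : Type*} [AddCommGroup A] {p : ℕ} [Fact p.Prime]
    [Finite (AddCommGroup.primaryComponent A p)] {k : ℕ}
    (hdvd : p ^ k ∣ Nat.card (AddCommGroup.primaryComponent A p)) :
    k ≤ padicValNat p (Nat.card (AddCommGroup.primaryComponent A p)) :=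
  (padicValNat_dvd_iff_le (Nat.card_pos (α := AddCommGroup.primaryComponent A p)).ne').mp hdvd

/-! ## §2. Route R with a `Ш`-defect `k`, at one cyclotomic datum, and on the leaf -/

section Squeeze

variable {W : WeierstrassCurve ℚ} [W.IsElliptic] [W.IsGloballyMinimal] {p : ℕ} [Fact p.Prime]

/-- **ROUTE R WITH A `Ш`-DEFECT — core, at one cyclotomic datum.** Setting of `identity` (good
ordinary Eisenstein pair, `p ≠ 2`, `rank E(ℚ) = 1`, `ord_p [T¹](ϖ·L_p) = vc ≠ 0`) plus: `v ≤ ord_p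
Reg_p` at the canonical datum (`hv`), the DEFECTIVE squeeze `hb : vc + 1 + 2·ord_p #E(ℚ)_tors ≤ v +
ord_p ∏c_ℓ + 2·ord_p #Ẽ(𝔽_p) + k`, and a descent certificate `hk : p^k ∣ #Ш(E/ℚ)[p^∞]`. Then
`ord_p h(0) = 0`, `char X = (g)` with `ι g = ϖ·L_p(f,α)` (MAZUR'S MAIN CONJECTURE at `D`),
`#Ш(E/ℚ)[p^∞] = p^k` EXACTLY, Schneider and `ord_p Reg_p = v` at every canonical datum. (`k = 0` is
`core`.) Facts: Wuthrich Thm. 16, BMS Thm. 1.7, Mazur–Tate `σ` — PUBLISHED.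
[cite: Wuthrich2014, Thm. 16 (p. 397)] [cite: BalakrishnanMullerStein2015, Thm. 1.7]
[cite: MazurSteinTate2006, Thm. 1.3] -/
theorem core_of_shaDefect (hW16 : Wuthrich2014.charIdeal_dvd_padicLFunction)
    (hS : Schneider1985_order_charGenerator_odd) (hMT : mazur_tate_sigma_exists_odd) (hp : p ≠ 2)
    (hgood : W.HasGoodReductionAtPrime p) (hord : ¬ (p : ℤ) ∣ W.frobeniusTrace p)
    (hred : ¬ W.HasIrreducibleModPGaloisRep p) (hrk : W.mordellWeilRank = 1)
    {vc : ℤ} (hvc : vc ≠ 0) (hc : AnalyticCoeffOneVal W p vc)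
    {v : ℤ} (hv : ∀ Dh : PAdicHeightData W p, Dh.IsCanonical → v ≤ (padicRegulator Dh).valuation)
    {k : ℕ} (hb : vc + 1 + 2 * padicValNat p W.torsionOrder ≤
      v + padicValNat p W.tamagawaProduct + 2 * padicValNat p (W.reductionPointCount p) + k)
    (hk : p ^ k ∣ Nat.card (AddCommGroup.primaryComponent W.sha p))
    {κ : ZpExtension ℚ p} {γ : Field.absoluteGaloisGroup ℚ}
    (hκ : κ.IsCyclotomic) (hγ : κ.IsTopGenerator γ) (hγ' : IsCyclotomicVariable p γ)
    [NeZero (W.conductorNorm ℤ)] {f : CuspForm (Gamma0 (W.conductorNorm ℤ)) 2} (hf : IsNewformOf W f)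
    {ϖ : ℚ} (hϖ : (ϖ : ℝ) * W.realPeriodRat = plusPeriod f) (D : W.SelmerDualData κ γ)
    [Module.Finite (IwasawaAlgebra p) D.X] :
    D.IsTorsion ∧
      (∃ g : IwasawaAlgebra p, D.charIdeal = Ideal.span {g} ∧
        iwasawaToPowerSeries p g = C (ϖ : ℚ_[p]) * padicLFunction f (unitRoot W p : ℚ_[p])) ∧
      Nat.card (AddCommGroup.primaryComponent W.sha p) = p ^ k ∧
      ∀ Dh : PAdicHeightData W p, Dh.IsCanonical →
        SchneiderConjecture Dh ∧ (padicRegulator Dh).valuation = v := by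
  obtain ⟨hX, hfin, fE, h, hchar', hfE0, hιg', hh0, hvh, key⟩ :=
    identity hW16 hS hMT hp hgood hord hred hrk hvc hc hκ hγ hγ' hf hϖ D
  haveI : Finite (AddCommGroup.primaryComponent W.sha p) := hfin
  -- the descent certificate: `k ≤ ord_p #Ш[p^∞]`
  have hkle : (k : ℤ) ≤ padicValNat p (Nat.card (AddCommGroup.primaryComponent W.sha p)) := by
    exact_mod_cast le_padicValNat_card_of_pow_dvd hk
  -- the squeeze at the canonical datum: `ord_p h(0) = 0`, `ord_p #Ш[p^∞] = k`, `ord_p Reg_p = v`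
  have sq : ∀ Dh : PAdicHeightData W p, Dh.IsCanonical → SchneiderConjecture Dh ∧
      (padicRegulator Dh).valuation = v ∧
      padicValNat p (Nat.card (AddCommGroup.primaryComponent W.sha p)) ≤ k ∧
      ((constantCoeff h : ℤ_[p]) : ℚ_[p]).valuation = 0 := by
    intro Dh hDh
    obtain ⟨hSch, hid⟩ := key Dh hDh
    have hvR := hv Dh hDh
    refine ⟨hSch, by linarith, ?_, by linarith⟩
    have : (padicValNat p (Nat.card (AddCommGroup.primaryComponent W.sha p)) : ℤ) ≤ k := by linarith
    exact_mod_cast this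
  obtain ⟨Dh₀, hDh₀, -⟩ := existsUnique_isCanonical_of_odd hMT W p hp hgood hord
  obtain ⟨-, -, hSle, hh0v⟩ := sq Dh₀ hDh₀
  have hunit : IsUnit h := isUnit_of_valuation_constantCoeff_eq_zero hh0 hh0v
  have hcard : Nat.card (AddCommGroup.primaryComponent W.sha p) = p ^ k :=
    card_addPrimaryComponent_eq_pow_of_dvd_of_le hk hSle
  refine ⟨hX, ⟨fE * h, ?_, hιg'⟩, hcard, fun Dh hDh ↦ ⟨(sq Dh hDh).1, (sq Dh hDh).2.1⟩⟩
  rw [hchar']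
  exact ((span_eq_span_iff_isUnit hfE0 rfl).mpr hunit).symm

/-- **Route R with a `Ш`-defect ⇒ MAZUR'S MAIN CONJECTURE** (good ordinary Eisenstein pair, `p ≠ 2`,
`rank E(ℚ) = 1`; W16, BMS 1.7, Mazur–Tate `σ`; the certificates `vc`, `v`, the defective squeeze
with defect `k`, and `p^k ∣ #Ш(E/ℚ)[p^∞]`). [cite: Wuthrich2014, Thm. 16 (p. 397)]
[cite: BalakrishnanMullerStein2015, Thm. 1.7] -/
theorem mazurMainConjecture_of_coeffOneVal_of_regulatorGE_of_shaDefect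
    (hW16 : Wuthrich2014.charIdeal_dvd_padicLFunction) (hS : Schneider1985_order_charGenerator_odd)
    (hMT : mazur_tate_sigma_exists_odd) (hp : p ≠ 2) (hgood : W.HasGoodReductionAtPrime p)
    (hord : ¬ (p : ℤ) ∣ W.frobeniusTrace p) (hred : ¬ W.HasIrreducibleModPGaloisRep p)
    (hrk : W.mordellWeilRank = 1) {vc : ℤ} (hvc : vc ≠ 0) (hc : AnalyticCoeffOneVal W p vc)
    {v : ℤ} (hv : ∀ Dh : PAdicHeightData W p, Dh.IsCanonical → v ≤ (padicRegulator Dh).valuation)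
    {k : ℕ} (hb : vc + 1 + 2 * padicValNat p W.torsionOrder ≤
      v + padicValNat p W.tamagawaProduct + 2 * padicValNat p (W.reductionPointCount p) + k)
    (hk : p ^ k ∣ Nat.card (AddCommGroup.primaryComponent W.sha p)) :
    MazurMainConjecture W p := by
  intro κ γ hκ hγ hγ' _ f hf ϖ hϖ D
  haveI : Module.Finite (IwasawaAlgebra p) D.X := D.module_finite_holds hγ
  obtain ⟨hX, hMC, -, -⟩ :=
    core_of_shaDefect hW16 hS hMT hp hgood hord hred hrk hvc hc hv hb hk hκ hγ hγ' hf hϖ D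
  exact ⟨hX, hMC⟩

end Squeeze

/-! ## §3. On the rank-one leaf: MC ∧ `BSD(E,p)` ∧ `#Ш[p^∞] = p^k`; the Cassels–Tate shapes -/

section Leaf

variable {W : WeierstrassCurve ℚ} [W.IsElliptic] [W.IsGloballyMinimal] {p : ℕ} [Fact p.Prime]

/-- **ROUTE R WITH A `Ш`-DEFECT ON THE RANK-ONE LEAF — HEADLINE: the two route-R certificates with
defect `k` (`vc + 1 + 2·ord_p #tors ≤ v + ord_p ∏c_ℓ + 2·ord_p #Ẽ(𝔽_p) + k`) plus a descent
certificate `p^k ∣ #Ш(E/ℚ)[p^∞]` ⇒ Mazur's main conjecture ∧ `BSD(E,p)`.** `BSD(E,p)` via x1a's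
`RankOne.Leaf.bsdp_of_mazurMainConjecture_of_schneider` (the coefficient is the Schneider certificate,
Perrin-Riou 1987 + modularity + GZK). Either Greenberg–Vatsal type; NO `#Ш(E/ℚ)_an`.
[cite: Wuthrich2014, Thm. 16 (p. 397)] [cite: BalakrishnanMullerStein2015, Thm. 1.7]
[cite: MazurSteinTate2006, Thm. 1.3] [cite: PerrinRiou1987, §1.4 Cor. 1.8] -/
theorem _root_.Summit.BirchSwinnertonDyer.Rank1Residual.X1.RankOne.Leaf.mazurMainConjecture_and_bsdp_of_regulatorGE_of_shaDefect
    (hW16 : Wuthrich2014.charIdeal_dvd_padicLFunction) (hS : Schneider1985_order_charGenerator_odd)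
    (hPR : perrinRiou_rankOne_leadingTerms_odd) (hMT : mazur_tate_sigma_exists_odd)
    (hmod : nonempty_modularParametrizationData) (hGZK : rank_eq_analyticRank_of_analyticRank_le_one)
    (hL : RankOne.Leaf W p) {vc : ℤ} (hvc : vc ≠ 0) (hc : AnalyticCoeffOneVal W p vc)
    {v : ℤ} (hv : ∀ Dh : PAdicHeightData W p, Dh.IsCanonical → v ≤ (padicRegulator Dh).valuation)
    {k : ℕ} (hb : vc + 1 + 2 * padicValNat p W.torsionOrder ≤
      v + padicValNat p W.tamagawaProduct + 2 * padicValNat p (W.reductionPointCount p) + k)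
    (hk : p ^ k ∣ Nat.card (AddCommGroup.primaryComponent W.sha p)) :
    MazurMainConjecture W p ∧ BSDp W p := by
  have hX := isClassX1_of_classX1 hL.1
  have hMC : MazurMainConjecture W p :=
    mazurMainConjecture_of_coeffOneVal_of_regulatorGE_of_shaDefect hW16 hS hMT hX.two_ne
      hX.hasGoodReductionAtPrime hX.not_dvd_frobeniusTrace hX.not_hasIrreducibleModPGaloisRep
      (hL.mordellWeilRank_eq_one hGZK) hvc hc hv hb hk
  exact ⟨hMC, hL.bsdp_of_mazurMainConjecture_of_schneider hS hPR hMT hmod hGZK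
    (hL.schneider_of_coeffOneVal hPR hGZK hmod hc hvc) hMC⟩

/-- **And the certificate pins `Ш`: `#Ш(E/ℚ)[p^∞] = p^k` exactly**, Schneider and `ord_p Reg_p = v`
at the canonical datum. [cite: Wuthrich2014, Thm. 16 (p. 397)] [cite: BalakrishnanMullerStein2015, Thm. 1.7] -/
theorem _root_.Summit.BirchSwinnertonDyer.Rank1Residual.X1.RankOne.Leaf.card_shaPrimary_eq_pow_of_regulatorGE_of_shaDefect
    (hW16 : Wuthrich2014.charIdeal_dvd_padicLFunction) (hS : Schneider1985_order_charGenerator_odd)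
    (hMT : mazur_tate_sigma_exists_odd) (hmod : nonempty_modularParametrizationData)
    (hGZK : rank_eq_analyticRank_of_analyticRank_le_one)
    (hL : RankOne.Leaf W p) {vc : ℤ} (hvc : vc ≠ 0) (hc : AnalyticCoeffOneVal W p vc)
    {v : ℤ} (hv : ∀ Dh : PAdicHeightData W p, Dh.IsCanonical → v ≤ (padicRegulator Dh).valuation)
    {k : ℕ} (hb : vc + 1 + 2 * padicValNat p W.torsionOrder ≤
      v + padicValNat p W.tamagawaProduct + 2 * padicValNat p (W.reductionPointCount p) + k)
    (hk : p ^ k ∣ Nat.card (AddCommGroup.primaryComponent W.sha p)) :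
    Nat.card (AddCommGroup.primaryComponent W.sha p) = p ^ k ∧
      ∀ Dh : PAdicHeightData W p, Dh.IsCanonical →
        SchneiderConjecture Dh ∧ (padicRegulator Dh).valuation = v := by
  have hX := isClassX1_of_classX1 hL.1
  obtain ⟨κ, hκ, γ, hγ, hγ'⟩ := exists_isCyclotomic_isTopGenerator_isCyclotomicVariable_holds p
  obtain ⟨D⟩ := W.nonempty_selmerDualData_holds κ γ hγ
  haveI : NeZero (W.conductorNorm ℤ) := ⟨(W.conductorNorm_pos_holds).ne'⟩
  obtain ⟨Dm⟩ := hmod W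
  obtain ⟨ϖ, -, hϖ, -⟩ := Dm.exists_rat_mul_realPeriodRat_eq_plusPeriod
  haveI : Module.Finite (IwasawaAlgebra p) D.X := D.module_finite_holds hγ
  obtain ⟨-, -, hcard, hReg⟩ := core_of_shaDefect hW16 hS hMT hX.two_ne hX.hasGoodReductionAtPrime
    hX.not_dvd_frobeniusTrace hX.not_hasIrreducibleModPGaloisRep (hL.mordellWeilRank_eq_one hGZK) hvc
    hc hv hb hk hκ hγ hγ' Dm.isNewformOf hϖ D
  exact ⟨hcard, hReg⟩

/-- **Cassels–Tate shape (one element, defect 2):** on the rank-one leaf `Ш(E/ℚ)` is finite (GZK),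
so the Cassels–Tate pairing (`hCT` = bsd.S18, Silverman X.4.14; PUBLISHED) makes `#Ш(E/ℚ)` a perfect
square; ONE non-zero `p`-torsion element of `Ш(E/ℚ)` (a `p`-descent with `#Sel^{(p)} > #E(ℚ)/p`)
then gives `p² ∣ #Ш(E/ℚ)[p^∞]`, and route R with defect `2` closes: MC ∧ `BSD(E,p)` ∧
`#Ш(E/ℚ)[p^∞] = p²`. The shape for the census classes with `#Ш_an = p²` at every curve (371522j @3).
[cite: SilvermanAEC2009, Thm. X.4.14] [cite: Wuthrich2014, Thm. 16 (p. 397)]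
[cite: BalakrishnanMullerStein2015, Thm. 1.7] [cite: PerrinRiou1987, §1.4 Cor. 1.8] -/
theorem _root_.Summit.BirchSwinnertonDyer.Rank1Residual.X1.RankOne.Leaf.mazurMainConjecture_and_bsdp_of_regulatorGE_of_casselsTate_of_exists_torsion
    (hW16 : Wuthrich2014.charIdeal_dvd_padicLFunction) (hS : Schneider1985_order_charGenerator_odd)
    (hPR : perrinRiou_rankOne_leadingTerms_odd) (hMT : mazur_tate_sigma_exists_odd)
    (hmod : nonempty_modularParametrizationData) (hGZK : rank_eq_analyticRank_of_analyticRank_le_one)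
    (hCT : exists_casselsTate_pairing (K := ℚ))
    (hL : RankOne.Leaf W p) {vc : ℤ} (hvc : vc ≠ 0) (hc : AnalyticCoeffOneVal W p vc)
    {v : ℤ} (hv : ∀ Dh : PAdicHeightData W p, Dh.IsCanonical → v ≤ (padicRegulator Dh).valuation)
    (hb : vc + 1 + 2 * padicValNat p W.torsionOrder ≤
      v + padicValNat p W.tamagawaProduct + 2 * padicValNat p (W.reductionPointCount p) + 2)
    (hw : ∃ x : W.sha, x ≠ 0 ∧ p • x = 0) :
    MazurMainConjecture W p ∧ BSDp W p ∧ Nat.card (AddCommGroup.primaryComponent W.sha p) = p ^ 2 := by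
  -- `Ш` finite on the leaf (GZK), `#Ш` a square (Cassels–Tate), `p ∣ #Ш` (the element) ⇒ `2 ≤ ord_p #Ш`
  obtain ⟨-, hfin⟩ := hGZK W (le_of_eq hL.2)
  haveI : Finite W.sha := hfin
  have hsq : IsSquare W.shaOrder := isSquare_shaOrder_of_casselsTate hCT W hfin
  have hn : W.shaOrder ≠ 0 := (WeierstrassCurve.shaOrder_pos W hfin).ne'
  have h2 : 2 ≤ padicValNat p W.shaOrder :=
    Typed.two_le_padicValNat_of_isSquare_of_dvd hsq hn (Typed.dvd_shaOrder_of_exists_torsion W p hw)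
  -- transfer to the `p`-primary component
  have h2' : 2 ≤ padicValNat p (Nat.card (AddCommGroup.primaryComponent W.sha p)) := by
    rwa [padicValNat_card_addPrimaryComponent]
  have hk : p ^ 2 ∣ Nat.card (AddCommGroup.primaryComponent W.sha p) :=
    (padicValNat_dvd_iff_le (Nat.card_pos (α := AddCommGroup.primaryComponent W.sha p)).ne').mpr h2'
  have hb' : vc + 1 + 2 * padicValNat p W.torsionOrder ≤
      v + padicValNat p W.tamagawaProduct + 2 * padicValNat p (W.reductionPointCount p) + (2 : ℕ) := by
    exact_mod_cast hb
  obtain ⟨hMC, hBSD⟩ := hL.mazurMainConjecture_and_bsdp_of_regulatorGE_of_shaDefect hW16 hS hPR hMT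
    hmod hGZK hvc hc hv hb' hk
  exact ⟨hMC, hBSD, (hL.card_shaPrimary_eq_pow_of_regulatorGE_of_shaDefect hW16 hS hMT hmod hGZK hvc hc
    hv hb' hk).1⟩

/-- **Cassels–Tate shape, general even defect `2k`:** `p^{2k−1} ∣ #Ш(E/ℚ)` (e.g. an injection
`(ℤ/p)^{2k−1} ↪ Ш(E/ℚ)` from a descent, `Typed.pow_dvd_shaOrder_of_injective`) + Cassels–Tate + GZK
⇒ `p^{2k} ∣ #Ш(E/ℚ)[p^∞]`; with the defective squeeze at `2k`: MC ∧ `BSD(E,p)`.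
[cite: SilvermanAEC2009, Thm. X.4.14] [cite: Wuthrich2014, Thm. 16 (p. 397)]
[cite: BalakrishnanMullerStein2015, Thm. 1.7] [cite: PerrinRiou1987, §1.4 Cor. 1.8] -/
theorem _root_.Summit.BirchSwinnertonDyer.Rank1Residual.X1.RankOne.Leaf.mazurMainConjecture_and_bsdp_of_regulatorGE_of_casselsTate_of_pow_dvd
    (hW16 : Wuthrich2014.charIdeal_dvd_padicLFunction) (hS : Schneider1985_order_charGenerator_odd)
    (hPR : perrinRiou_rankOne_leadingTerms_odd) (hMT : mazur_tate_sigma_exists_odd)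
    (hmod : nonempty_modularParametrizationData) (hGZK : rank_eq_analyticRank_of_analyticRank_le_one)
    (hCT : exists_casselsTate_pairing (K := ℚ))
    (hL : RankOne.Leaf W p) {vc : ℤ} (hvc : vc ≠ 0) (hc : AnalyticCoeffOneVal W p vc)
    {v : ℤ} (hv : ∀ Dh : PAdicHeightData W p, Dh.IsCanonical → v ≤ (padicRegulator Dh).valuation)
    {k : ℕ} (hb : vc + 1 + 2 * padicValNat p W.torsionOrder ≤
      v + padicValNat p W.tamagawaProduct + 2 * padicValNat p (W.reductionPointCount p) + 2 * k)
    (hdvd : p ^ (2 * k - 1) ∣ W.shaOrder) :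
    MazurMainConjecture W p ∧ BSDp W p ∧
      Nat.card (AddCommGroup.primaryComponent W.sha p) = p ^ (2 * k) := by
  obtain ⟨-, hfin⟩ := hGZK W (le_of_eq hL.2)
  haveI : Finite W.sha := hfin
  have hsq : IsSquare W.shaOrder := isSquare_shaOrder_of_casselsTate hCT W hfin
  have hn : W.shaOrder ≠ 0 := (WeierstrassCurve.shaOrder_pos W hfin).ne'
  have h2 : 2 * k ≤ padicValNat p W.shaOrder :=
    Typed.two_mul_le_padicValNat_of_isSquare_of_pow_dvd hsq hn hdvd
  have h2' : 2 * k ≤ padicValNat p (Nat.card (AddCommGroup.primaryComponent W.sha p)) := by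
    rwa [padicValNat_card_addPrimaryComponent]
  have hk : p ^ (2 * k) ∣ Nat.card (AddCommGroup.primaryComponent W.sha p) :=
    (padicValNat_dvd_iff_le (Nat.card_pos (α := AddCommGroup.primaryComponent W.sha p)).ne').mpr h2'
  have hb' : vc + 1 + 2 * padicValNat p W.torsionOrder ≤
      v + padicValNat p W.tamagawaProduct + 2 * padicValNat p (W.reductionPointCount p) +
        (2 * k : ℕ) := by
    exact_mod_cast hb
  obtain ⟨hMC, hBSD⟩ := hL.mazurMainConjecture_and_bsdp_of_regulatorGE_of_shaDefect hW16 hS hPR hMT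
    hmod hGZK hvc hc hv hb' hk
  exact ⟨hMC, hBSD, (hL.card_shaPrimary_eq_pow_of_regulatorGE_of_shaDefect hW16 hS hMT hmod hGZK hvc hc
    hv hb' hk).1⟩

/-- **Booking (isogeny) form of the `Ш`-defect row:** the certificates `(vc, v, k)` and the descent
certificate `p^k ∣ #Ш(E′)[p^∞]` may be read on ANY globally minimal curve `E′ ∼ E` of the class
(`RankOne.Leaf.of_isIsogenous`; Cassels' isogeny invariance of `BSD(·,p)` at analytic rank `≤ 1`).
[cite: Wuthrich2014, Thm. 16 (p. 397)] [cite: BalakrishnanMullerStein2015, Thm. 1.7]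
[cite: PerrinRiou1987, §1.4 Cor. 1.8] [cite: MilneADT2006, Thm. I.7.3] -/
theorem _root_.Summit.BirchSwinnertonDyer.Rank1Residual.X1.RankOne.Leaf.bsdp_of_isIsogenous_of_regulatorGE_of_shaDefect
    (hW16 : Wuthrich2014.charIdeal_dvd_padicLFunction) (hS : Schneider1985_order_charGenerator_odd)
    (hPR : perrinRiou_rankOne_leadingTerms_odd) (hMT : mazur_tate_sigma_exists_odd)
    (hmod : nonempty_modularParametrizationData) (hmod' : hasEntireLFunction_rat)
    (hGZK : rank_eq_analyticRank_of_analyticRank_le_one) (hCassels : bsdRHS_eq_of_isIsogenous)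
    (hL : RankOne.Leaf W p) {W' : WeierstrassCurve ℚ} [W'.IsElliptic] [W'.IsGloballyMinimal]
    (hiso : IsIsogenous W W') {vc : ℤ} (hvc : vc ≠ 0) (hc : AnalyticCoeffOneVal W' p vc)
    {v : ℤ} (hv : ∀ Dh : PAdicHeightData W' p, Dh.IsCanonical → v ≤ (padicRegulator Dh).valuation)
    {k : ℕ} (hb : vc + 1 + 2 * padicValNat p W'.torsionOrder ≤
      v + padicValNat p W'.tamagawaProduct + 2 * padicValNat p (W'.reductionPointCount p) + k)
    (hk : p ^ k ∣ Nat.card (AddCommGroup.primaryComponent W'.sha p)) :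
    BSDp W p :=
  (Rank1ResidualX1Isogeny.bsdp_iff_of_isIsogenous hGZK hmod' hCassels W W' hiso p (by rw [hL.2])).mpr
    ((hL.of_isIsogenous hiso).mazurMainConjecture_and_bsdp_of_regulatorGE_of_shaDefect hW16 hS hPR
      hMT hmod hGZK hvc hc hv hb hk).2

end Leaf

end Summit.BirchSwinnertonDyer.Rank1Residual.X1.RankOneRegulatorSqueeze

end
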